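import Literature.Analysis.FluidPDE.TorusLpOperatorFactsRieszFreqProofs
import Literature.Analysis.FluidPDE.FracLaplacianSmooth
import Literature.Analysis.FunctionSpaces.TorusKernelApproximation
import Literature.Analysis.FunctionSpaces.TorusSobolevNormFacts
import Literature.Analysis.Fourier.LowPassKernel
import HarnessLib

/-!
# The commutator estimate of Luo–Titi (Lemma 6) / Buckmaster–Vicol (Lemma B.1): discharge of
  `Torus.commutator_Lp_bound`

Analysis/FluidPDE proof file, sibling of the facts file `TorusLpOperatorFacts` and of
`TorusLpOperatorFactsRieszFreqProofs` (which discharges the two Riesz-potential bounds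
`rieszPotential_Lp_bound(_of_freqSupport)`). It **discharges** the named fact
`Literature.Analysis.FluidPDE.Torus.commutator_Lp_bound` (D-0014):

* T. Luo, E. S. Titi, Calc. Var. PDE 59 (2020) = arXiv:1808.07595, §3.5 **Lemma 6** ("Let
  `a ∈ C²(𝕋³)`. For `1 < p < ∞` and any smooth `f ∈ L^p(𝕋³)`,
  `‖|∇|⁻¹P_{≠0}(a P_{≥k} f)‖_{L^p} ≲ k⁻¹ ‖∇²a‖_{L^∞} ‖f‖_{L^p}`"), = T. Buckmaster, V. Vicol,
  Ann. of Math. 189 (2019), App. B **Lemma B.1**, in the corrected exact-support rendering of the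
  facts file (constant `C_a = A ≥ max_{j≤2} ‖Dʲa‖_∞`, `f` with Fourier support in `{|k| ≥ κ}`):
  `theorem commutator_Lp_bound_holds : commutator_Lp_bound`.

## The argument (the printed proof, with smooth Littlewood–Paley cut-offs)

Luo–Titi (following BV19): "`|∇|⁻¹P_{≠0}(a P_{≥k}f) = |∇|⁻¹P_{≥k/2}(P_{≤k/2}a P_{≥k}f) +
|∇|⁻¹P_{≠0}(P_{≥k/2}a P_{≥k}f)`", then the three bounds `‖P_{≤k/2}‖_{p→p} ≲ 1`,
`‖|∇|⁻¹P_{≥k/2}‖_{p→p} ≲ k⁻¹`, `‖|∇|⁻¹P_{≠0}‖_{p→p} ≲ 1`, Hölder, and an `L^∞` bound for the two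
pieces of `a`. Here the sharp projection `P_{≤κ/2}` is replaced by the smooth low-pass smoothing
`aL(x) = ∫_{ℝ³} g_κ(z) a(x - proj z) dz` with the kernel `g_κ = 𝓕⁻¹[χ(4ξ/κ)]` of
`Fourier/LowPassKernel` (`𝓕g_κ = 0` on `‖ξ‖ ≥ κ/2`, `∫g_κ = 1`, even, `‖g_κ‖₁ = M`,
`∫‖z‖²|g_κ| = κ⁻²m`):

1. `aL` is a real trigonometric polynomial with spectrum in `|k| < κ/2`, hence smooth, with
   `‖aL‖_∞ ≤ M‖a‖_∞ ≤ MA` and `‖a - aL‖_∞ ≤ ½κ⁻²m‖D²a‖_∞ ≤ ½κ⁻²mA`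
   (`FunctionSpaces/TorusKernelApproximation`: scalar multiplier identity, band-limited scalars,
   even-kernel approximation bound);
2. `aL • f` is smooth with Fourier support in `{|k| ≥ κ/2}`
   (`isFreqSupportedOff_lowPassSmooth_smul`: `(aL f)^(k) = ∑_{|m|<κ/2} âL(m) f̂(k-m)` and
   `|k - m| < κ` when `|k| < κ/2`);
3. `(-Δ)^{-1/2}(af) = (-Δ)^{-1/2}(aL f) + (-Δ)^{-1/2}((a - aL) f)` (additivity of the spectral
   `fracLaplacian` for the bounded symbol of exponent `-1/2`, summable coefficients), and
   * `‖(-Δ)^{-1/2}(aL f)‖_p ≤ C₂(κ/2)⁻¹‖aL f‖_p ≤ 2C₂κ⁻¹MA‖f‖_p` for `κ ≥ 2` by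
     `rieszPotential_Lp_bound_of_freqSupport` at `κ/2 ≥ 1`, and `≤ C₁MA‖f‖_p ≤ 2C₁κ⁻¹MA‖f‖_p`
     for `1 ≤ κ < 2` by `rieszPotential_Lp_bound`;
   * `‖(-Δ)^{-1/2}((a - aL)f)‖_p ≤ C₁‖(a - aL)f‖_p ≤ ½C₁κ⁻²mA‖f‖_p ≤ C₁mκ⁻¹A‖f‖_p`;
   so `C = 2(C₁ + C₂)M + C₁m` works (`commutator_Lp_bound_of_riesz`).

The plain bound `rieszPotential_Lp_bound` is re-derived here from the Bernstein-type one
(`rieszPotential_Lp_bound_of_freqSupport_imp`: apply it at `κ = 1` to `u - ⨍u`), so that the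
reduction `commutator_Lp_bound_of_riesz` has the single hypothesis
`rieszPotential_Lp_bound_of_freqSupport (Fin 3)`, discharged by
`rieszPotential_Lp_bound_of_freqSupport_holds` (`TorusLpOperatorFactsRieszFreqProofs`).

## Mathlib / tree search

Mathlib: `eLpNorm_le_mul_eLpNorm_of_ae_le_mul`, `eLpNorm_add_le`, `eLpNorm_sub_le`, `eLpNorm_const`,
`eLpNorm_le_eLpNorm_of_exponent_le`, `continuous_tsum`, `HasSum.unique`. Tree (all reused):
`Torus.fracLaplacian`, `fracSymbol`, `fracSymbol_smul_mFourier_smul`,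
`norm_fracSymbol_smul_mFourier_smul_le` (`FractionalNSTorus`, `FracLaplacianSmooth`);
`Torus.summable_norm_mFourierCoeff_of_isSmooth`, `mFourierCoeff_complexify_sub_const_smul`
(`TorusFourierSeries`); `Torus.integral_mFourier`, `trigPoly`, `freqBall` (`TorusTrigPoly`);
`mFourierCoeff_finset_sum` (`TorusFourierModes`), `mFourierCoeff_const_smul` (`TorusSobolevNorm`),
`mFourierCoeff_add` (`TorusSobolevNormFacts`), `mFourierCoeff_sub`; the low-pass kernel
(`Fourier/LowPassKernel`) and the kernel-smoothing files `TorusKernelSmoothing`,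
`TorusKernelApproximation`. Nothing on products with band-limited functions or on the spectral
fractional Laplacian for negative exponents (`lean search 'fracLaplacian.*neg|IsFreqSupportedOff.*smul'`).

## References

* T. Luo, E. S. Titi, *Non-uniqueness of weak solutions to hyperviscous Navier–Stokes
  equations: on sharpness of J.-L. Lions exponent*, Calc. Var. PDE 59 (2020) =
  arXiv:1808.07595, §3.5, Lemma 6 and its proof (held text `paper:arxiv-1808.07595`, page
  file p0007, lines 50–75). [`LuoTiti2020`]
* T. Buckmaster, V. Vicol, Ann. of Math. 189 (2019) = arXiv:1709.10033, App. B, Lemma B.1 and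
  its proof. [`BuckmasterVicol2019AnnMath`]
* L. Grafakos, *Classical Fourier Analysis*, 3rd ed. (2014), §3.1.1, §4.3.2, §5.1
  (Bernstein-type multipliers). [`Grafakos2014`]
-/

noncomputable section

open MeasureTheory Set Filter Function UnitAddTorus Complex
open scoped ENNReal NNReal ContDiff FourierTransform RealInnerProductSpace

namespace Literature.Analysis.FluidPDE

namespace Torus

open FunctionSpaces FunctionSpaces.Torus

variable {d : Type*} [Fintype d]

/-! ## The spectral fractional Laplacian for non-positive exponents -/

section Nonpos

/-- For `α ≤ 0` the symbol is bounded by one: `(4π²|k|²)^α ≤ 1` (`|k|² ∈ {0} ∪ [1, ∞)` for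
`k ∈ ℤ^d`, and `4π² ≥ 1`). [folklore] -/
theorem fracSymbol_le_one_of_nonpos {θ : ℝ} (hθ : θ ≤ 0) (k : d → ℤ) : fracSymbol θ k ≤ 1 := by
  unfold fracSymbol
  by_cases hk : k = 0
  · subst hk
    rw [freqNormSq_zero, mul_zero]
    rcases eq_or_lt_of_le hθ with h | h
    · rw [h, Real.rpow_zero]
    · rw [Real.zero_rpow h.ne]; exact zero_le_one
  · refine Real.rpow_le_one_of_one_le_of_nonpos ?_ hθ
    have h1 : 1 ≤ freqNormSq k := one_le_freqNormSq_of_ne_zero hk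
    have hπ : 1 ≤ 4 * Real.pi ^ 2 := by nlinarith [Real.two_le_pi]
    nlinarith

/-- Summability of the modes of `(-Δ)^α u`, `α ≤ 0`, for a field with absolutely summable
Fourier coefficients. [folklore] -/
theorem summable_fracSymbol_mul_norm_of_nonpos {θ : ℝ} (hθ : θ ≤ 0)
    {u : UnitAddTorus d → EuclideanSpace ℝ d}
    (hsum : Summable fun k => ‖mFourierCoeff (EuclideanSpace.complexify ∘ u) k‖) :
    Summable fun k : d → ℤ => fracSymbol θ k * ‖mFourierCoeff (EuclideanSpace.complexify ∘ u) k‖ :=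
  Summable.of_nonneg_of_le (fun k => mul_nonneg (fracSymbol_nonneg θ k) (norm_nonneg _))
    (fun k => by
      calc fracSymbol θ k * ‖mFourierCoeff (EuclideanSpace.complexify ∘ u) k‖
          ≤ 1 * ‖mFourierCoeff (EuclideanSpace.complexify ∘ u) k‖ :=
            mul_le_mul_of_nonneg_right (fracSymbol_le_one_of_nonpos hθ k) (norm_nonneg _)
        _ = _ := one_mul _) hsum

/-- The complex modes `σ_k • (e_k(x) • û(k))` are summable (`α ≤ 0`). [folklore] -/
theorem summable_fracSymbol_smul_mFourier_smul_of_nonpos {θ : ℝ} (hθ : θ ≤ 0)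
    {u : UnitAddTorus d → EuclideanSpace ℝ d}
    (hsum : Summable fun k => ‖mFourierCoeff (EuclideanSpace.complexify ∘ u) k‖) (x : UnitAddTorus d) :
    Summable fun k : d → ℤ =>
      fracSymbol θ k • (mFourier k x • mFourierCoeff (EuclideanSpace.complexify ∘ u) k) :=
  Summable.of_norm_bounded (summable_fracSymbol_mul_norm_of_nonpos hθ hsum)
    fun k => norm_fracSymbol_smul_mFourier_smul_le θ k x _

/-- **The defining series of `(-Δ)^α u` converges** (`α ≤ 0`, summable coefficients). [folklore] -/
theorem hasSum_fracLaplacian_of_nonpos {θ : ℝ} (hθ : θ ≤ 0) {u : UnitAddTorus d → EuclideanSpace ℝ d}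
    (hsum : Summable fun k => ‖mFourierCoeff (EuclideanSpace.complexify ∘ u) k‖) (x : UnitAddTorus d) :
    HasSum (fun k : d → ℤ => EuclideanSpace.realPart
      (fracSymbol θ k • (mFourier k x • mFourierCoeff (EuclideanSpace.complexify ∘ u) k)))
      (fracLaplacian θ u x) := by
  rw [fracLaplacian_def]
  exact ((summable_fracSymbol_smul_mFourier_smul_of_nonpos hθ hsum x).hasSum).mapL EuclideanSpace.realPart

/-- **`(-Δ)^α u` is continuous** (`α ≤ 0`, summable coefficients; uniform convergence). [folklore] -/
theorem continuous_fracLaplacian_of_nonpos {θ : ℝ} (hθ : θ ≤ 0) {u : UnitAddTorus d → EuclideanSpace ℝ d}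
    (hsum : Summable fun k => ‖mFourierCoeff (EuclideanSpace.complexify ∘ u) k‖) :
    Continuous (fracLaplacian θ u) := by
  have h : (fracLaplacian θ u) = fun x => ∑' k : d → ℤ, EuclideanSpace.realPart
      (fracSymbol θ k • (mFourier k x • mFourierCoeff (EuclideanSpace.complexify ∘ u) k)) :=
    funext fun x => ((hasSum_fracLaplacian_of_nonpos hθ hsum x).tsum_eq).symm
  rw [h]
  refine continuous_tsum (fun k => ?_) (summable_fracSymbol_mul_norm_of_nonpos hθ hsum)
    (fun k x => norm_realPart_fracSymbol_smul_le θ k x _)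
  exact EuclideanSpace.realPart.continuous.comp
    ((continuous_const (y := fracSymbol θ k)).smul ((mFourier k).continuous.smul continuous_const))

/-- **Additivity of `(-Δ)^α`** on continuous fields with summable coefficients (`α ≤ 0`). [folklore] -/
theorem fracLaplacian_add_of_nonpos {θ : ℝ} (hθ : θ ≤ 0) {u v : UnitAddTorus d → EuclideanSpace ℝ d}
    (hu : Continuous u) (hv : Continuous v)
    (hsu : Summable fun k => ‖mFourierCoeff (EuclideanSpace.complexify ∘ u) k‖)
    (hsv : Summable fun k => ‖mFourierCoeff (EuclideanSpace.complexify ∘ v) k‖) (x : UnitAddTorus d) :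
    fracLaplacian θ (fun y => u y + v y) x = fracLaplacian θ u x + fracLaplacian θ v x := by
  set w : UnitAddTorus d → EuclideanSpace ℝ d := fun y => u y + v y with hw
  have hcoef : ∀ k, mFourierCoeff (EuclideanSpace.complexify ∘ w) k =
      mFourierCoeff (EuclideanSpace.complexify ∘ u) k + mFourierCoeff (EuclideanSpace.complexify ∘ v) k := by
    intro k
    have hfun : (EuclideanSpace.complexify ∘ w) =
        (EuclideanSpace.complexify ∘ u) + (EuclideanSpace.complexify ∘ v) := by
      funext y; simp [hw, map_add]
    rw [hfun, mFourierCoeff_add (integrable_complexify_comp hu.integrable_unitAddTorus)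
      (integrable_complexify_comp hv.integrable_unitAddTorus)]
  have hsuv : Summable fun k => ‖(mFourierCoeff (EuclideanSpace.complexify ∘ w) k)‖ := by
    refine Summable.of_nonneg_of_le (fun k => norm_nonneg _) (fun k => ?_) (hsu.add hsv)
    rw [hcoef]
    exact norm_add_le _ _
  have h1 := hasSum_fracLaplacian_of_nonpos hθ hsuv x
  have h2 := (hasSum_fracLaplacian_of_nonpos hθ hsu x).add (hasSum_fracLaplacian_of_nonpos hθ hsv x)
  refine h1.unique ?_
  refine h2.congr_fun fun k => ?_
  rw [hcoef, smul_add, smul_add, map_add]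

/-- **`(-Δ)^α` depends only on the weighted coefficients**: if `σ_k û(k) = σ_k v̂(k)` for all
`k` then `(-Δ)^α u = (-Δ)^α v` (definition). [folklore] -/
theorem fracLaplacian_eq_of_forall_fracSymbol_smul_eq (θ : ℝ) {u v : UnitAddTorus d → EuclideanSpace ℝ d}
    (h : ∀ k, ((fracSymbol θ k : ℝ) : ℂ) • mFourierCoeff (EuclideanSpace.complexify ∘ u) k =
      ((fracSymbol θ k : ℝ) : ℂ) • mFourierCoeff (EuclideanSpace.complexify ∘ v) k) :
    fracLaplacian θ u = fracLaplacian θ v := by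
  funext x
  rw [fracLaplacian_def, fracLaplacian_def]
  congr 1
  refine tsum_congr fun k => ?_
  rw [fracSymbol_smul_mFourier_smul, fracSymbol_smul_mFourier_smul, h k]

end Nonpos

/-! ## `rieszPotential_Lp_bound` from the Bernstein-type bound (removing the mean) -/

section MeanFree

/-- The Fourier coefficients of a constant field vanish off the zero mode. [folklore] -/
theorem mFourierCoeff_complexify_const_of_ne_zero (c : EuclideanSpace ℝ d) {k : d → ℤ} (hk : k ≠ 0) :
    mFourierCoeff (EuclideanSpace.complexify ∘ fun _ : UnitAddTorus d => c) k = 0 := by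
  rw [mFourierCoeff_eq_integral_volume]
  simp only [Function.comp_apply]
  rw [integral_smul_const, integral_mFourier, if_neg (neg_ne_zero.2 hk), zero_smul]

/-- Subtracting a constant changes only the zero mode: for `k ≠ 0`,
`𝓕(u - c)(k) = 𝓕u(k)`. [folklore] -/
theorem mFourierCoeff_complexify_sub_const {u : UnitAddTorus d → EuclideanSpace ℝ d}
    (hu : Integrable u volume) (c : EuclideanSpace ℝ d) {k : d → ℤ} (hk : k ≠ 0) :
    mFourierCoeff (EuclideanSpace.complexify ∘ fun x => u x - c) k =
      mFourierCoeff (EuclideanSpace.complexify ∘ u) k := by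
  have hfun : (EuclideanSpace.complexify ∘ fun x => u x - c) =
      (EuclideanSpace.complexify ∘ u) - (EuclideanSpace.complexify ∘ fun _ : UnitAddTorus d => c) := by
    funext x; simp [map_sub]
  rw [hfun, mFourierCoeff_sub (integrable_complexify_comp hu)
    (integrable_complexify_comp (integrable_const c)), mFourierCoeff_complexify_const_of_ne_zero c hk,
    sub_zero]

/-- **`u - ⨍u` has Fourier support off the unit ball** (its zero mode vanishes, and
`|k|² < 1` forces `k = 0` on `ℤ^d`). [folklore] -/
theorem isFreqSupportedOff_one_sub_average {u : UnitAddTorus d → EuclideanSpace ℝ d} (hu : IsSmooth u) :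
    IsFreqSupportedOff 1 (fun x => u x - ∫ y, u y) := by
  intro k hk
  have hk0 : k = 0 := by
    by_contra h
    have := one_le_freqNormSq_of_ne_zero h
    linarith
  subst hk0
  have hint : Integrable (fun x => u x - ∫ y, u y) volume := hu.integrable.sub (integrable_const _)
  rw [mFourierCoeff_eq_integral_volume]
  simp only [neg_zero, mFourier_zero, ContinuousMap.one_apply, one_smul, Function.comp_apply]
  have h1 : ∫ x, EuclideanSpace.complexify (u x - ∫ y, u y) =
      EuclideanSpace.complexify (∫ x, (u x - ∫ y, u y)) :=
    (EuclideanSpace.complexify (ι := d)).toContinuousLinearMap.integral_comp_comm hint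
  rw [h1, integral_sub hu.integrable (integrable_const _), integral_const, probReal_univ, one_smul,
    sub_self, map_zero]

/-- **`(-Δ)^α u = (-Δ)^α (u - ⨍u)`** for `α ≠ 0` (the zero mode is annihilated, the other modes
are unchanged). [folklore] -/
theorem fracLaplacian_sub_average {θ : ℝ} (hθ : θ ≠ 0) {u : UnitAddTorus d → EuclideanSpace ℝ d}
    (hu : Integrable u volume) :
    fracLaplacian θ (fun x => u x - ∫ y, u y) = fracLaplacian θ u := by
  refine fracLaplacian_eq_of_forall_fracSymbol_smul_eq θ fun k => ?_
  by_cases hk : k = 0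
  · subst hk
    rw [fracSymbol_zero hθ, Complex.ofReal_zero, zero_smul, zero_smul]
  · rw [mFourierCoeff_complexify_sub_const hu _ hk]

/-- On the probability space `T^d`: `‖x ↦ c‖_{L^p} = ‖c‖`. [folklore] -/
theorem eLpNorm_const_torus (c : EuclideanSpace ℝ d) {p : ℝ≥0∞} (hp : p ≠ 0) :
    eLpNorm (fun _ : UnitAddTorus d => c) p volume = ‖c‖ₑ := by
  rw [eLpNorm_const c hp (IsProbabilityMeasure.ne_zero volume), measure_univ, ENNReal.one_rpow, mul_one]

/-- The mean is dominated by the `L^p` norm (`1 ≤ p`, probability space): `‖∫ u‖ₑ ≤ ‖u‖_{L^p}`. [folklore] -/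
theorem enorm_integral_le_eLpNorm {u : UnitAddTorus d → EuclideanSpace ℝ d} (hu : AEStronglyMeasurable u volume)
    {p : ℝ≥0∞} (hp : 1 ≤ p) : ‖∫ x, u x‖ₑ ≤ eLpNorm u p volume :=
  calc ‖∫ x, u x‖ₑ ≤ ∫⁻ x, ‖u x‖ₑ := enorm_integral_le_lintegral_enorm _
    _ = eLpNorm u 1 volume := (eLpNorm_one_eq_lintegral_enorm).symm
    _ ≤ eLpNorm u p volume := eLpNorm_le_eLpNorm_of_exponent_le hp hu

/-- `‖u - ⨍u‖_{L^p} ≤ 2‖u‖_{L^p}` (`1 ≤ p`). [folklore] -/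
theorem eLpNorm_sub_average_le {u : UnitAddTorus d → EuclideanSpace ℝ d} (hu : Continuous u)
    {p : ℝ≥0∞} (hp : 1 ≤ p) :
    eLpNorm (fun x => u x - ∫ y, u y) p volume ≤ 2 * eLpNorm u p volume := by
  have hp0 : p ≠ 0 := (zero_lt_one.trans_le hp).ne'
  have h1 : eLpNorm (fun x => u x - ∫ y, u y) p volume ≤
      eLpNorm u p volume + eLpNorm (fun _ : UnitAddTorus d => ∫ y, u y) p volume :=
    eLpNorm_sub_le (f := u) (g := fun _ => ∫ y, u y) hu.aestronglyMeasurable aestronglyMeasurable_const hp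
  calc eLpNorm (fun x => u x - ∫ y, u y) p volume
      ≤ eLpNorm u p volume + eLpNorm (fun _ : UnitAddTorus d => ∫ y, u y) p volume := h1
    _ ≤ eLpNorm u p volume + eLpNorm u p volume := by
        rw [eLpNorm_const_torus _ hp0]
        exact add_le_add le_rfl (enorm_integral_le_eLpNorm hu.aestronglyMeasurable hp)
    _ = 2 * eLpNorm u p volume := (two_mul _).symm

/-- **The Bernstein-type bound implies the plain `L^p` bound of `|∇|⁻¹P_{≠0}`**: apply
`rieszPotential_Lp_bound_of_freqSupport d` at `κ = 1` to `u - ⨍u` (Fourier support off the unit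
ball), using `(-Δ)^{-1/2}u = (-Δ)^{-1/2}(u - ⨍u)` and `‖u - ⨍u‖_p ≤ 2‖u‖_p`; the constant doubles.
[folklore] -/
theorem rieszPotential_Lp_bound_of_freqSupport_imp (h : rieszPotential_Lp_bound_of_freqSupport d) :
    rieszPotential_Lp_bound d := by
  intro p hp hp'
  obtain ⟨C, hC⟩ := h p hp hp'
  refine ⟨2 * C, fun u hu => ?_⟩
  have hu₀ : IsSmooth (fun x => u x - ∫ y, u y) := hu.sub (isSmooth_const _)
  have h1 := hC 1 le_rfl _ hu₀ (isFreqSupportedOff_one_sub_average hu)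
  rw [fracLaplacian_sub_average (by norm_num) hu.integrable, inv_one, ENNReal.ofReal_one, mul_one] at h1
  calc eLpNorm (fracLaplacian (-(1 / 2)) u) p volume
      ≤ C * eLpNorm (fun x => u x - ∫ y, u y) p volume := h1
    _ ≤ C * (2 * eLpNorm u p volume) := mul_le_mul' le_rfl (eLpNorm_sub_average_le hu.continuous hp.le)
    _ = ((2 * C : ℝ≥0) : ℝ≥0∞) * eLpNorm u p volume := by
        rw [ENNReal.coe_mul, ENNReal.coe_ofNat]
        ring

end MeanFree

/-! ## The low-pass split of a scalar multiplier on `T^d` -/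

section LowPass

variable [DecidableEq d]

open Literature.Analysis.Fourier

/-- `latticeVec (k - m) = latticeVec k - latticeVec m`. [folklore] -/
theorem latticeVec_sub' (k m : d → ℤ) : latticeVec (k - m) = latticeVec k - latticeVec m := by
  ext i
  simp [latticeVec_apply]

omit [DecidableEq d] in
/-- `(κ/2)² ≤ |k|²` as a bound on `‖latticeVec k‖`. [folklore] -/
theorem half_le_norm_latticeVec_of_sq_le [DecidableEq d] {κ : ℝ} (hκ : 0 ≤ κ) {k : d → ℤ}
    (h : (κ / 2) ^ 2 ≤ freqNormSq k) : κ / 2 ≤ ‖latticeVec k‖ := by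
  rw [← norm_latticeVec_sq] at h
  have h2 := Real.sqrt_le_sqrt h
  rwa [Real.sqrt_sq (by positivity), Real.sqrt_sq (norm_nonneg _)] at h2

omit [DecidableEq d] in
/-- `|k|² < κ²` from a bound on `‖latticeVec k‖`. [folklore] -/
theorem freqNormSq_lt_of_norm_latticeVec_lt [DecidableEq d] {κ : ℝ} {k : d → ℤ}
    (h : ‖latticeVec k‖ < κ) : freqNormSq k < κ ^ 2 := by
  rw [← norm_latticeVec_sq]
  exact pow_lt_pow_left₀ h (norm_nonneg _) two_ne_zero

omit [DecidableEq d] in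
/-- `‖latticeVec k‖ < κ/2` from `|k|² < (κ/2)²`. [folklore] -/
theorem norm_latticeVec_lt_of_freqNormSq_lt [DecidableEq d] {κ : ℝ} (hκ : 0 ≤ κ) {k : d → ℤ}
    (h : freqNormSq k < (κ / 2) ^ 2) : ‖latticeVec k‖ < κ / 2 := by
  rw [← norm_latticeVec_sq] at h
  exact lt_of_pow_lt_pow_left₀ 2 (by positivity) h

omit [DecidableEq d] in
/-- **Sup bound for the low part**: `‖P̃_{≤κ/2} a‖_∞ ≤ ‖g₁‖₁ ‖a‖_∞`. [folklore] -/
theorem norm_lowPassSmooth_le {κ : ℝ} (hκ : 0 < κ) {a : UnitAddTorus d → ℝ} {A₀ : ℝ}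
    (hA₀ : ∀ y, ‖a y‖ ≤ A₀) (x : UnitAddTorus d) :
    ‖∫ z : EuclideanSpace ℝ d, lowPassKernel (EuclideanSpace ℝ d) κ z • a (x - proj z)‖ ≤
      lowPassMass (EuclideanSpace ℝ d) * A₀ := by
  rw [← integral_abs_lowPassKernel (E := EuclideanSpace ℝ d) hκ]
  exact norm_integral_kernel_smul_le (integrable_lowPassKernel hκ) hA₀ x

omit [DecidableEq d] in
/-- **Approximation bound for the high part**:
`‖a - P̃_{≤κ/2} a‖_∞ ≤ (‖D²a‖_∞/2) κ⁻² m₂(g₁)`. [folklore] -/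
theorem norm_sub_lowPassSmooth_le {κ : ℝ} (hκ : 0 < κ) {a : UnitAddTorus d → ℝ} (ha : IsContDiff 2 a)
    {A₂ : ℝ} (hA₂ : ∀ y, ‖iteratedFDeriv ℝ 2 (lift a) y‖ ≤ A₂) (x : UnitAddTorus d) :
    ‖a x - ∫ z : EuclideanSpace ℝ d, lowPassKernel (EuclideanSpace ℝ d) κ z • a (x - proj z)‖ ≤
      A₂ / 2 * ((κ ^ 2)⁻¹ * lowPassMoment (EuclideanSpace ℝ d)) := by
  rw [← integral_norm_sq_mul_abs_lowPassKernel (E := EuclideanSpace ℝ d) hκ]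
  exact norm_sub_integral_kernel_smul_le_of_even ha hA₂ (integrable_lowPassKernel hκ) (integral_lowPassKernel hκ)
    (lowPassKernel_neg κ) (integrable_norm_sq_mul_abs_lowPassKernel hκ) x

/-- **The low part has spectrum in `|k| < κ/2`**: its Fourier coefficients vanish for
`(κ/2)² ≤ |k|²` (`𝓕 g_κ = 0` on `‖ξ‖ ≥ κ/2`). [folklore] -/
theorem mFourierCoeff_lowPassSmooth_eq_zero {κ : ℝ} (hκ : 0 < κ) {a : UnitAddTorus d → ℝ} (ha : Continuous a)
    {k : d → ℤ} (hk : (κ / 2) ^ 2 ≤ freqNormSq k) :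
    mFourierCoeff (fun x => ((∫ z : EuclideanSpace ℝ d,
      lowPassKernel (EuclideanSpace ℝ d) κ z • a (x - proj z) : ℝ) : ℂ)) k = 0 := by
  rw [mFourierCoeff_ofReal_integral_kernel_smul (integrable_lowPassKernel hκ) ha,
    fourierIntegral_ofReal_lowPassKernel_of_le_norm hκ (half_le_norm_latticeVec_of_sq_le hκ.le hk), zero_mul]

/-- The low part's coefficients vanish off the frequency ball of radius `⌈κ/2⌉`. [folklore] -/
theorem mFourierCoeff_lowPassSmooth_eq_zero_of_not_mem {κ : ℝ} (hκ : 0 < κ) {a : UnitAddTorus d → ℝ}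
    (ha : Continuous a) {k : d → ℤ} (hk : k ∉ freqBall ⌈κ / 2⌉₊) :
    mFourierCoeff (fun x => ((∫ z : EuclideanSpace ℝ d,
      lowPassKernel (EuclideanSpace ℝ d) κ z • a (x - proj z) : ℝ) : ℂ)) k = 0 := by
  refine mFourierCoeff_lowPassSmooth_eq_zero hκ ha ?_
  rw [mem_freqBall, not_le] at hk
  have h1 : κ / 2 ≤ (⌈κ / 2⌉₊ : ℝ) := Nat.le_ceil _
  have h2 : (κ / 2) ^ 2 ≤ ((⌈κ / 2⌉₊ : ℕ) : ℝ) ^ 2 := pow_le_pow_left₀ (by positivity) h1 2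
  exact h2.trans hk.le

/-- **The low part is smooth** (a real trigonometric polynomial of degree `< ⌈κ/2⌉`). [folklore] -/
theorem isSmooth_lowPassSmooth {κ : ℝ} (hκ : 0 < κ) {a : UnitAddTorus d → ℝ} (ha : Continuous a) :
    IsSmooth (fun x => ∫ z : EuclideanSpace ℝ d, lowPassKernel (EuclideanSpace ℝ d) κ z • a (x - proj z)) :=
  isSmooth_of_mFourierCoeff_eq_zero (continuous_integral_kernel_smul (integrable_lowPassKernel hκ) ha)
    (fun _ hk => mFourierCoeff_lowPassSmooth_eq_zero_of_not_mem hκ ha hk)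

omit [DecidableEq d] in
/-- Shift of Fourier coefficients by a character: `𝓕(e_m • F)(k) = 𝓕F(k - m)`. [folklore] -/
theorem mFourierCoeff_mFourier_smul {V : Type*} [NormedAddCommGroup V] [NormedSpace ℂ V]
    (m : d → ℤ) (F : UnitAddTorus d → V) (k : d → ℤ) :
    mFourierCoeff (fun x => mFourier m x • F x) k = mFourierCoeff F (k - m) := by
  rw [mFourierCoeff_eq_integral_volume, mFourierCoeff_eq_integral_volume]
  refine integral_congr_ae (Eventually.of_forall fun x => ?_)
  dsimp only
  rw [smul_smul, ← mFourier_add, show -k + m = -(k - m) by abel]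

/-- **Spectrum of a product with a band-limited scalar** (the Fourier side of
`P_{≥κ/2}(P_{≤κ/2}a · P_{≥κ}f) = P_{≤κ/2}a · P_{≥κ}f`): if `f` has Fourier support off the
ball of radius `κ` then `(P̃_{≤κ/2} a) • f` has Fourier support off the ball of radius `κ/2`
(`(aL • f)^(k) = ∑_{|m| < κ/2} âL(m) f̂(k - m)` and `|k - m| < κ` for `|k| < κ/2`). [folklore] -/
theorem isFreqSupportedOff_lowPassSmooth_smul {κ : ℝ} (hκ : 0 < κ) {a : UnitAddTorus d → ℝ}
    (ha : Continuous a) {f : UnitAddTorus d → EuclideanSpace ℝ d} (hf : Continuous f)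
    (hfs : IsFreqSupportedOff κ f) :
    IsFreqSupportedOff (κ / 2) (fun x =>
      (∫ z : EuclideanSpace ℝ d, lowPassKernel (EuclideanSpace ℝ d) κ z • a (x - proj z)) • f x) := by
  set θ : UnitAddTorus d → ℝ := fun x =>
    ∫ z : EuclideanSpace ℝ d, lowPassKernel (EuclideanSpace ℝ d) κ z • a (x - proj z) with hθ_def
  have hθc : Continuous θ := continuous_integral_kernel_smul (integrable_lowPassKernel hκ) ha
  set N : ℕ := ⌈κ / 2⌉₊ with hN
  set S : Finset (d → ℤ) := freqBall N with hS
  set c : (d → ℤ) → ℂ := fun m => mFourierCoeff (fun x => (θ x : ℂ)) m with hc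
  have hθP : (fun x => (θ x : ℂ)) = trigPoly S c :=
    ofReal_eq_trigPoly_of_mFourierCoeff_eq_zero hθc
      (fun _ hk => mFourierCoeff_lowPassSmooth_eq_zero_of_not_mem hκ ha hk)
  set F : UnitAddTorus d → EuclideanSpace ℂ d := EuclideanSpace.complexify ∘ f with hF
  have hFi : Integrable F volume := integrable_complexify_comp hf.integrable_unitAddTorus
  -- the complexified product as a finite sum of modulated copies of `F`
  have hprod : (EuclideanSpace.complexify ∘ fun x => θ x • f x) =
      fun x => ∑ m ∈ S, c m • (mFourier m x • F x) := by
    funext x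
    simp only [Function.comp_apply, map_smul, hF]
    rw [← Complex.coe_smul, show ((θ x : ℝ) : ℂ) = trigPoly S c x from congr_fun hθP x, trigPoly_apply,
      Finset.sum_smul]
    refine Finset.sum_congr rfl fun m _ => ?_
    rw [smul_eq_mul, mul_comm, mul_smul]
  intro k hk
  have hFc : Continuous F := EuclideanSpace.complexify.continuous.comp hf
  have hterm : ∀ m ∈ S, Integrable (fun x => c m • (mFourier m x • F x)) volume := fun m _ =>
    ((((mFourier m).continuous.smul hFc)).const_smul (c m)).integrable_unitAddTorus
  rw [hprod, mFourierCoeff_finset_sum S hterm]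
  refine Finset.sum_eq_zero fun m _ => ?_
  have h1 : mFourierCoeff (fun x => c m • (mFourier m x • F x)) k = c m • mFourierCoeff F (k - m) := by
    rw [show (fun x => c m • (mFourier m x • F x)) = c m • (fun x => mFourier m x • F x) from rfl,
      mFourierCoeff_const_smul, mFourierCoeff_mFourier_smul]
  rw [h1]
  by_cases hcm : c m = 0
  · rw [hcm, zero_smul]
  · -- `c m ≠ 0` forces `‖latticeVec m‖ < κ/2`
    have hm2 : ‖latticeVec m‖ < κ / 2 := by
      by_contra hle
      rw [not_lt] at hle
      apply hcm
      simp only [hc, hθ_def]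
      rw [mFourierCoeff_ofReal_integral_kernel_smul (integrable_lowPassKernel hκ) ha,
        fourierIntegral_ofReal_lowPassKernel_of_le_norm hκ hle, zero_mul]
    have hk2 : ‖latticeVec k‖ < κ / 2 := norm_latticeVec_lt_of_freqNormSq_lt hκ.le hk
    have hkm : ‖latticeVec (k - m)‖ < κ := by
      rw [latticeVec_sub']
      calc ‖latticeVec k - latticeVec m‖ ≤ ‖latticeVec k‖ + ‖latticeVec m‖ := norm_sub_le _ _
        _ < κ / 2 + κ / 2 := add_lt_add hk2 hm2
        _ = κ := by ring
    rw [hfs (k - m) (freqNormSq_lt_of_norm_latticeVec_lt hkm), smul_zero]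

end LowPass

/-! ## The commutator estimate from the two Riesz-potential bounds -/

section Commutator

open Literature.Analysis.Fourier

/-- Pointwise: `‖θ x • v‖ ≤ B ‖v‖` from `‖θ x‖ ≤ B`, in the form consumed by
`eLpNorm_le_mul_eLpNorm_of_ae_le_mul`. [folklore] -/
theorem eLpNorm_smul_le_of_norm_le {ι : Type*} [Fintype ι] {θ : UnitAddTorus ι → ℝ} {B : ℝ}
    (hθ : ∀ x, ‖θ x‖ ≤ B) (f : UnitAddTorus ι → EuclideanSpace ℝ ι) (p : ℝ≥0∞) :
    eLpNorm (fun x => θ x • f x) p volume ≤ ENNReal.ofReal B * eLpNorm f p volume :=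
  eLpNorm_le_mul_eLpNorm_of_ae_le_mul (Eventually.of_forall fun x => by
    rw [norm_smul]
    exact mul_le_mul_of_nonneg_right (hθ x) (norm_nonneg _)) p

/-- **Luo–Titi 2020, Lemma 6 / Buckmaster–Vicol 2019, Lemma B.1, from the Riesz-potential
bounds.** The commutator estimate `commutator_Lp_bound` follows from the Bernstein-type bound
`rieszPotential_Lp_bound_of_freqSupport (Fin 3)` (which also yields the plain bound
`rieszPotential_Lp_bound (Fin 3)`, `rieszPotential_Lp_bound_of_freqSupport_imp`) by the printed
Littlewood–Paley argument with smooth cut-offs: split `a = aL + aH` with the low-pass smoothing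
`aL = g_κ ⊛ a` (`Fourier/LowPassKernel`: spectrum in `|k| < κ/2`, `‖aL‖_∞ ≤ ‖g₁‖₁‖a‖_∞`,
`‖aH‖_∞ ≤ ½κ⁻²m₂(g₁)‖D²a‖_∞`, `TorusKernelApproximation`); `aL • f` is smooth with Fourier
support off `κ/2`, so `‖|∇|⁻¹(aL f)‖_p ≲ κ⁻¹‖aL f‖_p ≲ κ⁻¹ A ‖f‖_p` (for `κ < 2` the plain bound
and `κ⁻¹ > 1/2`), while `‖|∇|⁻¹(aH f)‖_p ≲ ‖aH f‖_p ≲ κ⁻² A ‖f‖_p ≤ κ⁻¹ A ‖f‖_p`.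
[cite: LuoTiti2020, §3.5 Lemma 6 (proof)] -/
theorem commutator_Lp_bound_of_riesz (h2 : rieszPotential_Lp_bound_of_freqSupport (Fin 3)) :
    commutator_Lp_bound := by
  classical
  have h1 : rieszPotential_Lp_bound (Fin 3) := rieszPotential_Lp_bound_of_freqSupport_imp h2
  intro p hp hp'
  obtain ⟨C₁, hC₁⟩ := h1 p hp hp'
  obtain ⟨C₂, hC₂⟩ := h2 p hp hp'
  have cmo : ∀ (C : ℝ≥0) (r : ℝ), (C : ℝ≥0∞) * ENNReal.ofReal r = ENNReal.ofReal (C * r) :=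
    fun C r => by rw [ENNReal.ofReal_mul (NNReal.coe_nonneg C), ENNReal.ofReal_coe_nnreal]
  set M : ℝ := lowPassMass (EuclideanSpace ℝ (Fin 3)) with hM
  set m : ℝ := lowPassMoment (EuclideanSpace ℝ (Fin 3)) with hm
  have hM0 : 0 ≤ M := lowPassMass_nonneg
  have hm0 : 0 ≤ m := lowPassMoment_nonneg
  refine ⟨2 * (C₁ + C₂) * M.toNNReal + C₁ * m.toNNReal, fun κ hκ a A ha hA f hf hfs => ?_⟩
  have hκ0 : 0 < κ := one_pos.trans_le hκ
  have hA0 : 0 ≤ A := (norm_nonneg _).trans (hA 0 (by norm_num) 0)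
  -- bounds on `a` from the iterated derivatives of its lift
  have hA₀ : ∀ y, ‖a y‖ ≤ A := fun y => by
    have h := hA 0 (by norm_num) (repr y)
    rwa [norm_iteratedFDeriv_zero, lift_repr] at h
  have hA₂ : ∀ y, ‖iteratedFDeriv ℝ 2 (lift a) y‖ ≤ A := fun y => hA 2 le_rfl y
  -- the split `a = aL + aH`
  set aL : UnitAddTorus (Fin 3) → ℝ := fun x =>
    ∫ z : EuclideanSpace ℝ (Fin 3), lowPassKernel (EuclideanSpace ℝ (Fin 3)) κ z • a (x - proj z) with haL_def
  have haLs : IsSmooth aL := isSmooth_lowPassSmooth hκ0 ha.continuous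
  have haL_le : ∀ x, ‖aL x‖ ≤ M * A := fun x => norm_lowPassSmooth_le hκ0 hA₀ x
  have haH_le : ∀ x, ‖a x - aL x‖ ≤ A / 2 * ((κ ^ 2)⁻¹ * m) := fun x =>
    norm_sub_lowPassSmooth_le hκ0 (ha.isContDiff (n := 2) (by decide)) hA₂ x
  set uL : UnitAddTorus (Fin 3) → EuclideanSpace ℝ (Fin 3) := fun x => aL x • f x with huL_def
  set uH : UnitAddTorus (Fin 3) → EuclideanSpace ℝ (Fin 3) := fun x => (a x - aL x) • f x with huH_def
  have huL : IsSmooth uL := haLs.smul' hf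
  have huH : IsSmooth uH := (ha.sub haLs).smul' hf
  have hsuL := summable_norm_mFourierCoeff_of_isSmooth huL
  have hsuH := summable_norm_mFourierCoeff_of_isSmooth huH
  have hhalf : (-(1 / 2 : ℝ)) ≤ 0 := by norm_num
  have hfrac : fracLaplacian (-(1 / 2)) (fun x => a x • f x) =
      fun x => fracLaplacian (-(1 / 2)) uL x + fracLaplacian (-(1 / 2)) uH x := by
    have hsum : (fun x => a x • f x) = fun x => uL x + uH x := by
      funext x
      simp only [huL_def, huH_def, sub_smul]
      abel
    rw [hsum]
    funext x
    exact fracLaplacian_add_of_nonpos hhalf huL.continuous huH.continuous hsuL hsuH x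
  -- `L^p` sizes of the two pieces
  have hLp_uL : eLpNorm uL p volume ≤ ENNReal.ofReal (M * A) * eLpNorm f p volume :=
    eLpNorm_smul_le_of_norm_le haL_le f p
  have hLp_uH : eLpNorm uH p volume ≤ ENNReal.ofReal (A / 2 * ((κ ^ 2)⁻¹ * m)) * eLpNorm f p volume :=
    eLpNorm_smul_le_of_norm_le haH_le f p
  have hsuppL : IsFreqSupportedOff (κ / 2) uL :=
    isFreqSupportedOff_lowPassSmooth_smul hκ0 ha.continuous hf.continuous hfs
  -- the low-frequency piece
  have hL : eLpNorm (fracLaplacian (-(1 / 2)) uL) p volume ≤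
      ENNReal.ofReal (2 * (C₁ + C₂) * M * (κ⁻¹ * A)) * eLpNorm f p volume := by
    by_cases hκ2 : 2 ≤ κ
    · have h := hC₂ (κ / 2) (by linarith) uL huL hsuppL
      calc eLpNorm (fracLaplacian (-(1 / 2)) uL) p volume
          ≤ C₂ * ENNReal.ofReal (κ / 2)⁻¹ * eLpNorm uL p volume := h
        _ ≤ C₂ * ENNReal.ofReal (κ / 2)⁻¹ * (ENNReal.ofReal (M * A) * eLpNorm f p volume) :=
            mul_le_mul' le_rfl hLp_uL
        _ = ENNReal.ofReal (C₂ * (κ / 2)⁻¹ * (M * A)) * eLpNorm f p volume := by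
            rw [← mul_assoc, cmo, ← ENNReal.ofReal_mul (by positivity)]
        _ ≤ ENNReal.ofReal (2 * (C₁ + C₂) * M * (κ⁻¹ * A)) * eLpNorm f p volume := by
            refine mul_le_mul' (ENNReal.ofReal_le_ofReal ?_) le_rfl
            have hC₁0 : (0 : ℝ) ≤ C₁ := C₁.coe_nonneg
            have : (C₂ : ℝ) * (κ / 2)⁻¹ * (M * A) = 2 * C₂ * M * (κ⁻¹ * A) := by
              field_simp
            rw [this]
            have hk : 0 ≤ κ⁻¹ * A := by positivity
            nlinarith [mul_nonneg (mul_nonneg hC₁0 hM0) hk]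
    · have h := hC₁ uL huL
      have hκ2' : 1 ≤ 2 * κ⁻¹ := by
        rw [le_mul_inv_iff₀ hκ0]; linarith [lt_of_not_ge hκ2]
      calc eLpNorm (fracLaplacian (-(1 / 2)) uL) p volume
          ≤ C₁ * eLpNorm uL p volume := h
        _ ≤ C₁ * (ENNReal.ofReal (M * A) * eLpNorm f p volume) := mul_le_mul' le_rfl hLp_uL
        _ = ENNReal.ofReal (C₁ * (M * A)) * eLpNorm f p volume := by
            rw [← mul_assoc, cmo]
        _ ≤ ENNReal.ofReal (2 * (C₁ + C₂) * M * (κ⁻¹ * A)) * eLpNorm f p volume := by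
            refine mul_le_mul' (ENNReal.ofReal_le_ofReal ?_) le_rfl
            have hC₁0 : (0 : ℝ) ≤ C₁ := C₁.coe_nonneg
            have hC₂0 : (0 : ℝ) ≤ C₂ := C₂.coe_nonneg
            have hMA : 0 ≤ M * A := by positivity
            calc (C₁ : ℝ) * (M * A) ≤ (C₁ * (M * A)) * (2 * κ⁻¹) :=
                  le_mul_of_one_le_right (by positivity) hκ2'
              _ ≤ ((C₁ + C₂) * (M * A)) * (2 * κ⁻¹) := by gcongr; linarith
              _ = 2 * (C₁ + C₂) * M * (κ⁻¹ * A) := by ring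
  -- the high-frequency piece
  have hH : eLpNorm (fracLaplacian (-(1 / 2)) uH) p volume ≤
      ENNReal.ofReal (C₁ * m * (κ⁻¹ * A)) * eLpNorm f p volume := by
    have h := hC₁ uH huH
    calc eLpNorm (fracLaplacian (-(1 / 2)) uH) p volume
        ≤ C₁ * eLpNorm uH p volume := h
      _ ≤ C₁ * (ENNReal.ofReal (A / 2 * ((κ ^ 2)⁻¹ * m)) * eLpNorm f p volume) := mul_le_mul' le_rfl hLp_uH
      _ = ENNReal.ofReal (C₁ * (A / 2 * ((κ ^ 2)⁻¹ * m))) * eLpNorm f p volume := by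
          rw [← mul_assoc, cmo]
      _ ≤ ENNReal.ofReal (C₁ * m * (κ⁻¹ * A)) * eLpNorm f p volume := by
          refine mul_le_mul' (ENNReal.ofReal_le_ofReal ?_) le_rfl
          have hC₁0 : (0 : ℝ) ≤ C₁ := C₁.coe_nonneg
          have hk1 : (κ ^ 2)⁻¹ ≤ κ⁻¹ := by
            rw [inv_le_inv₀ (by positivity) hκ0]
            nlinarith
          have hk0 : 0 ≤ (κ ^ 2)⁻¹ := by positivity
          calc (C₁ : ℝ) * (A / 2 * ((κ ^ 2)⁻¹ * m)) = (C₁ * m * A / 2) * (κ ^ 2)⁻¹ := by ring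
            _ ≤ (C₁ * m * A) * κ⁻¹ := by
                apply mul_le_mul _ hk1 hk0 (by positivity)
                have : 0 ≤ (C₁ : ℝ) * m * A := by positivity
                linarith
            _ = C₁ * m * (κ⁻¹ * A) := by ring
  -- combine
  have hmeasL : AEStronglyMeasurable (fracLaplacian (-(1 / 2)) uL) volume :=
    (continuous_fracLaplacian_of_nonpos hhalf hsuL).aestronglyMeasurable
  have hmeasH : AEStronglyMeasurable (fracLaplacian (-(1 / 2)) uH) volume :=
    (continuous_fracLaplacian_of_nonpos hhalf hsuH).aestronglyMeasurable
  calc eLpNorm (fracLaplacian (-(1 / 2)) (fun x => a x • f x)) p volume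
      = eLpNorm (fun x => fracLaplacian (-(1 / 2)) uL x + fracLaplacian (-(1 / 2)) uH x) p volume := by
        rw [hfrac]
    _ ≤ eLpNorm (fracLaplacian (-(1 / 2)) uL) p volume + eLpNorm (fracLaplacian (-(1 / 2)) uH) p volume :=
        eLpNorm_add_le hmeasL hmeasH hp.le
    _ ≤ ENNReal.ofReal (2 * (C₁ + C₂) * M * (κ⁻¹ * A)) * eLpNorm f p volume +
          ENNReal.ofReal (C₁ * m * (κ⁻¹ * A)) * eLpNorm f p volume := add_le_add hL hH
    _ = ((2 * (C₁ + C₂) * M.toNNReal + C₁ * m.toNNReal : ℝ≥0) : ℝ≥0∞) * ENNReal.ofReal (κ⁻¹ * A) *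
          eLpNorm f p volume := by
        rw [← add_mul, cmo]
        congr 1
        have hC₁0 : (0 : ℝ) ≤ C₁ := C₁.coe_nonneg
        have hC₂0 : (0 : ℝ) ≤ C₂ := C₂.coe_nonneg
        rw [← ENNReal.ofReal_add (by positivity) (by positivity)]
        congr 1
        simp only [NNReal.coe_add, NNReal.coe_mul, NNReal.coe_ofNat, Real.coe_toNNReal _ hM0,
          Real.coe_toNNReal _ hm0]
        ring

/-- **Luo–Titi 2020, Lemma 6 = Buckmaster–Vicol 2019, Lemma B.1 (commutator estimate) —
discharge of the named fact `commutator_Lp_bound`.** [cite: LuoTiti2020, §3.5 Lemma 6] -/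
theorem commutator_Lp_bound_holds : commutator_Lp_bound :=
  commutator_Lp_bound_of_riesz rieszPotential_Lp_bound_of_freqSupport_holds

end Commutator

end Torus

end Literature.Analysis.FluidPDE
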